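import Mathlib
import HarnessLib
import Summits.HubbardSuperconductivity.HubbardSuperconductivity.Theorems.KLProgrammeKLRegimeEngineV8DefsC3

/-!
# Route `KLProgramme` — ENGINE item stmt-HubbardSuperconductivity-20437 `KLRegimeEngineV17F2`, AMENDMENT 25 door (ii): `klC3W` IS MONOTONE — one WORST-CASE token value
# serves every admissible frame and band (cell gate-hubbard-kl, seat hubbard-kl-k3c2-p2 g21)

`klC3W d A G a l e` (…EngineV8DefsC3, p666215) reads the configuration only through `D := d − 4A` (decreasing: powers `D⁻²`, `D⁻³`, `D⁻¹`) and `G` (increasing, `G = 4 + 8/3·Gfr₁U² ≤ 5`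
under the value lane's door `8/3·Gfr₁U² ≤ 1`).  Hence a TEXT token can be fixed at the worst case `(D₀, 0, 5)` with `0 < D₀ ≤ B.Dtmin − 4Af` (e.g. `D₀ :=` the certified band's
`Dtmin − 1/20`, `4Af ≤ 1/20`): **`klC3W_le_worst`** `klC3W d A G a l e ≤ klC3W D₀ 0 5 a l e`, and the same for `klC3` (`klC3_le_worst`).  So the pinned `W`-rows of ANY admissible
configuration book under the single constant `klC3 D₀ 0 5 a_W l_W e_W` (`pinned_row(_shift)_W_le_klC3_worst`).  Arithmetic only.  0 kit · 0 lit.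
-/

noncomputable section

namespace Summit.HubbardSuperconductivity.HubbardSuperconductivity.Theorems.EngineV8

set_option linter.dupNamespace false -- summit = problem name (single-conjunct summit), D-0017

open Real Finset Literature.MathematicalPhysics.QuantumLattice Literature.Probability.LatticeModels
open Summit.HubbardSuperconductivity.HubbardSuperconductivity.Theorems.KLRegimeSplit
open Summit.HubbardSuperconductivity.HubbardSuperconductivity.Theorems.KLProgrammeLegKernels

/-- **`klC3W` at the worst case dominates**: `0 < D₀ ≤ d − 4A`, `0 ≤ G ≤ 5`, `a, l ≥ 0` ⇒ `klC3W d A G a l e ≤ klC3W D₀ 0 5 a l e`. -/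
theorem klC3W_le_worst {d A G a l e D₀ : ℝ} (hD₀ : 0 < D₀) (hD : D₀ ≤ d - 4 * A) (hG0 : 0 ≤ G) (hG : G ≤ 5) (ha : 0 ≤ a) (hl : 0 ≤ l) :
    klC3W d A G a l e ≤ klC3W D₀ 0 5 a l e := by
  rw [klC3W_eq, klC3W_eq]
  have hπ := Real.pi_pos
  have hps : 0 ≤ Real.pi * Real.sqrt 2 := by positivity
  have hCZ := klPinCZ_nonneg; have hCT := klPinCT_nonneg; have hCR := klPinCR_nonneg; have hCL := klPinCL_nonneg
  set D := d - 4 * A with hDdef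
  have hDpos : 0 < D := hD₀.trans_le hD
  have e0 : D₀ - 4 * 0 = D₀ := by ring
  rw [e0]
  -- reciprocal powers are antitone in `D`
  have h1 : 1 / D ≤ 1 / D₀ := one_div_le_one_div_of_le hD₀ hD
  have h2 : 1 / D ^ 2 ≤ 1 / D₀ ^ 2 := one_div_le_one_div_of_le (by positivity) (pow_le_pow_left₀ hD₀.le hD 2)
  have h3 : 1 / D ^ 3 ≤ 1 / D₀ ^ 3 := one_div_le_one_div_of_le (by positivity) (pow_le_pow_left₀ hD₀.le hD 3)
  -- term by term
  have tZ : 3 / π * klPinCZ * (2 * (Real.pi * Real.sqrt 2) * l / D ^ 2 +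
        a / 32 * (40 * (Real.pi * Real.sqrt 2) / D ^ 2 + 2 / D ^ 2 + 41 / 10 * (Real.pi * Real.sqrt 2) / D ^ 3)) ≤
      3 / π * klPinCZ * (2 * (Real.pi * Real.sqrt 2) * l / D₀ ^ 2 +
        a / 32 * (40 * (Real.pi * Real.sqrt 2) / D₀ ^ 2 + 2 / D₀ ^ 2 + 41 / 10 * (Real.pi * Real.sqrt 2) / D₀ ^ 3)) := by
    have hin : 2 * (Real.pi * Real.sqrt 2) * l / D ^ 2 + a / 32 * (40 * (Real.pi * Real.sqrt 2) / D ^ 2 + 2 / D ^ 2 + 41 / 10 * (Real.pi * Real.sqrt 2) / D ^ 3) ≤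
        2 * (Real.pi * Real.sqrt 2) * l / D₀ ^ 2 + a / 32 * (40 * (Real.pi * Real.sqrt 2) / D₀ ^ 2 + 2 / D₀ ^ 2 + 41 / 10 * (Real.pi * Real.sqrt 2) / D₀ ^ 3) := by
      have b1 : 2 * (Real.pi * Real.sqrt 2) * l / D ^ 2 ≤ 2 * (Real.pi * Real.sqrt 2) * l / D₀ ^ 2 := by
        rw [div_eq_mul_one_div, div_eq_mul_one_div _ (D₀ ^ 2)]; exact mul_le_mul_of_nonneg_left h2 (by positivity)
      have b2 : 40 * (Real.pi * Real.sqrt 2) / D ^ 2 ≤ 40 * (Real.pi * Real.sqrt 2) / D₀ ^ 2 := by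
        rw [div_eq_mul_one_div, div_eq_mul_one_div _ (D₀ ^ 2)]; exact mul_le_mul_of_nonneg_left h2 (by positivity)
      have b3 : 2 / D ^ 2 ≤ 2 / D₀ ^ 2 := by
        rw [div_eq_mul_one_div, div_eq_mul_one_div _ (D₀ ^ 2)]; exact mul_le_mul_of_nonneg_left h2 (by positivity)
      have b4 : 41 / 10 * (Real.pi * Real.sqrt 2) / D ^ 3 ≤ 41 / 10 * (Real.pi * Real.sqrt 2) / D₀ ^ 3 := by
        rw [div_eq_mul_one_div, div_eq_mul_one_div _ (D₀ ^ 3)]; exact mul_le_mul_of_nonneg_left h3 (by positivity)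
      have b5 := mul_le_mul_of_nonneg_left (show 40 * (Real.pi * Real.sqrt 2) / D ^ 2 + 2 / D ^ 2 + 41 / 10 * (Real.pi * Real.sqrt 2) / D ^ 3 ≤
          40 * (Real.pi * Real.sqrt 2) / D₀ ^ 2 + 2 / D₀ ^ 2 + 41 / 10 * (Real.pi * Real.sqrt 2) / D₀ ^ 3 by linarith) (by positivity : 0 ≤ a / 32)
      linarith
    exact mul_le_mul_of_nonneg_left hin (by positivity)
  have tT : 12 / π * (klPinCT + 2 * klPinCR) * (2 * a * (Real.pi * Real.sqrt 2 / D)) ≤ 12 / π * (klPinCT + 2 * klPinCR) * (2 * a * (Real.pi * Real.sqrt 2 / D₀)) := by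
    have : Real.pi * Real.sqrt 2 / D ≤ Real.pi * Real.sqrt 2 / D₀ := by
      rw [div_eq_mul_one_div, div_eq_mul_one_div _ D₀]; exact mul_le_mul_of_nonneg_left h1 hps
    have := mul_le_mul_of_nonneg_left this (by positivity : 0 ≤ 2 * a)
    exact mul_le_mul_of_nonneg_left this (by positivity)
  have tR : 3 / π * klPinCR * (2 * a * (Real.pi * Real.sqrt 2 / D)) * G ≤ 3 / π * klPinCR * (2 * a * (Real.pi * Real.sqrt 2 / D₀)) * 5 := by
    have hq : Real.pi * Real.sqrt 2 / D ≤ Real.pi * Real.sqrt 2 / D₀ := by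
      rw [div_eq_mul_one_div, div_eq_mul_one_div _ D₀]; exact mul_le_mul_of_nonneg_left h1 hps
    have h0 : 0 ≤ 3 / π * klPinCR * (2 * a * (Real.pi * Real.sqrt 2 / D₀)) := by positivity
    calc 3 / π * klPinCR * (2 * a * (Real.pi * Real.sqrt 2 / D)) * G ≤ 3 / π * klPinCR * (2 * a * (Real.pi * Real.sqrt 2 / D₀)) * G := by
          have := mul_le_mul_of_nonneg_left hq (by positivity : 0 ≤ 2 * a)
          exact mul_le_mul_of_nonneg_right (mul_le_mul_of_nonneg_left this (by positivity)) hG0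
      _ ≤ 3 / π * klPinCR * (2 * a * (Real.pi * Real.sqrt 2 / D₀)) * 5 := mul_le_mul_of_nonneg_left hG h0
  have tL : 3072 / π ^ 2 * (512 * l + 32 * a * G * klPinCL) ≤ 3072 / π ^ 2 * (512 * l + 32 * a * 5 * klPinCL) := by
    have : 32 * a * G * klPinCL ≤ 32 * a * 5 * klPinCL := by
      have := mul_le_mul_of_nonneg_left hG (by positivity : 0 ≤ 32 * a)
      exact mul_le_mul_of_nonneg_right this hCL
    have : 512 * l + 32 * a * G * klPinCL ≤ 512 * l + 32 * a * 5 * klPinCL := by linarith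
    exact mul_le_mul_of_nonneg_left this (by positivity)
  linarith

/-- **`klC3` at the worst case dominates.** -/
theorem klC3_le_worst {d A G a l e D₀ : ℝ} (hD₀ : 0 < D₀) (hD : D₀ ≤ d - 4 * A) (hG0 : 0 ≤ G) (hG : G ≤ 5) (ha : 0 ≤ a) (hl : 0 ≤ l) :
    klC3 d A G a l e ≤ klC3 D₀ 0 5 a l e := by
  rw [klC3_eq, klC3_eq]
  have := klC3W_le_worst (e := e) hD₀ hD hG0 hG ha hl
  linarith

variable {β : ℝ} {L : ℕ} [NeZero L]

/-- **The pinned direct `W`-row under the worst-case constant**: as `pinned_row_W_le_klC3W`, with `klC3W D₀ 0 5 a l e` on the right. -/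
theorem pinned_row_W_le_klC3W_worst {d A G a l e X D₀ : ℝ} (hD₀ : 0 < D₀) (hD : D₀ ≤ d - 4 * A) (hA : 0 ≤ A) (hA20 : 4 * A ≤ 1 / 20)
    (hG0 : 0 ≤ G) (hG : G ≤ 5) (ha : 0 ≤ a) (hl : 0 ≤ l) (hX : 0 ≤ X) (hβ : klBetaMin ≤ β) {n : ℕ} (hn : n ≤ nScales β)
    {r : ℝ} (hr : 0 < r) (hrΛ : r ≤ klScale klE0 (n + 1)) (hβL : β ^ 2 ≤ (L : ℝ)) :
    2 * ((klScale klE0 n - klScale klE0 (n + 1)) * klmsRowBound d A G (a * X) (l * X / klScale klE0 (n + 1)) β n (n + 2) (G * r) L) +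
        e * X * (512 * 15367) ≤ klC3W D₀ 0 5 a l e * X := by
  have h1 := pinned_row_W_le_klC3W (L := L) (e := e) (hD₀.trans_le hD) hA hA20 hG0 ha hl hX hβ hn hr hrΛ hβL
  have h2 := mul_le_mul_of_nonneg_right (klC3W_le_worst (e := e) hD₀ hD hG0 hG ha hl) hX
  exact h1.trans h2

/-- **The pinned crossed `W`-row under the worst-case constant.** -/
theorem pinned_row_shift_W_le_klC3W_worst {d A G a l e X D₀ : ℝ} (hD₀ : 0 < D₀) (hD : D₀ ≤ d - 4 * A) (hA : 0 ≤ A) (hA20 : 4 * A ≤ 1 / 20)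
    (hG0 : 0 ≤ G) (hG : G ≤ 5) (ha : 0 ≤ a) (hl : 0 ≤ l) (hX : 0 ≤ X) (hβ : klBetaMin ≤ β) {n : ℕ} (hn : n ≤ nScales β)
    {r : ℝ} (hr : 0 < r) (hrΛ : r ≤ klScale klE0 (n + 1)) (hβL : β ^ 2 ≤ (L : ℝ)) {s : ℝ} (hs : |s| = 2 * π / β) :
    2 * ((klScale klE0 n - klScale klE0 (n + 1)) * klmsRowBound d A G (a * X) (l * X / klScale klE0 (n + 1)) β n (n + 2) (|s| + G * r) L) +
        e * X * (512 * 15367) ≤ klC3W D₀ 0 5 a l e * X := by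
  have h1 := pinned_row_shift_W_le_klC3W (L := L) (e := e) (hD₀.trans_le hD) hA hA20 hG0 ha hl hX hβ hn hr hrΛ hβL hs
  have h2 := mul_le_mul_of_nonneg_right (klC3W_le_worst (e := e) hD₀ hD hG0 hG ha hl) hX
  exact h1.trans h2

end Summit.HubbardSuperconductivity.HubbardSuperconductivity.Theorems.EngineV8

end
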